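import Summits.BirchSwinnertonDyer.Rank1Residual.Additive.TameBranchAnalyticShaConverse
import Summits.BirchSwinnertonDyer.Rank1Residual.Additive.TameBranchAnalyticShaX3
import HarnessLib

/-!
# `BSD(E,p)` ⟺ THE MAIN CONJECTURE AT THE PAIR — the (M) and X3 twins (rank 0, EVERY odd `p`): on
# X4(M) ∩ {`ρ̄` onto}, X3♯(M) and X3♯(G-ord, `e = 2`) ∩ `I₀*` the upper half WITH `ℓ`,
# `ord_p #Ш[p^∞] + ord_p ℓ ≤ ord_p #Ш_an`, holds on every row with EQUALITY iff the Kato / Wuthrich element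
# generates `char_Λ X(E/ℚ_∞)`; a LOWER bound `ord_p #Ш_an ≤ ord_p #Ш[p^∞]` (in particular `BSD(E,p)`) closes
# the chain: `BSD(E,p)` + MC(pair) integrally + `ℓ = 1`
# (cell `b2b-bsdres`, sub-cell additive-p2 = X3♯(G-ord)/X4♯(G-ord), gen 32; part 8)

HONEST FRAMING (cell `b2b-bsdres`, run/shared/lean/b2b/bsd-rank1-residual/, verbatim in every
file): the goal of the cell is to DELETE the COMBINATION-SHAPED residual classes of the
Birch–Swinnerton-Dyer formula for ALL analytic-rank `≤ 1` elliptic curves over `ℚ` — "full BSD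
formula for every rank `≤ 1` curve in class `C`" assembled STRICTLY from published theorems — so
that the rank-`≤ 1` remainder becomes exactly the CONSTRUCTION-SHAPED classes, which are TYPED
(missing-input `Prop`s), NOT attempted. This is not "finishing BSD". Sub-cell additive-p2: the
classes X3♯(G-ord) / X4♯(G-ord) are CONSTRUCTION-SHAPED and stay so; the (M) rows belong to
additive-p1 / n1011 (bricks and class predicates consumed BY NAME); labels / RESIDUAL-MAP marks
UNCHANGED; nothing is booked (the lower bound on `#Ш[p^∞]` / `BSD(E,p)` enters ONLY as a HYPOTHESIS).
Theorems only; published inputs are explicit binders (`hK` Kato 2004 Thm. 17.4 (3), `hWu` Wuthrich 2014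
Thm. 16, `hmodD`, `hGZK`, `hmod`, `LeadingTermClauses W p Dh` = Delbourgo 2002 (B) for the datum). No
definition, no named fact, no `sorry`.

## What and why

Part 6 (`TameBranchAnalyticShaConverse`) gave, on X4♯(G-ord, `e = 2`) ∩ surj at rank 0, the upper half
WITH `ℓ` and its equality case (⟺ the Kato element generates). Of the 72 rank-0 defect-2 rows N < 2·10⁴
with `p ∣ #Ш_an` (gen 32 reading) only 4 are X4 ∩ Gord_e2 @ 5; 58 are X4(M) (54 @ 3, 4 @ 5), 3 are X3♯(M)
@ 3, 2 are X3♯(G-ord) @ 3 (and 5 are X4 ∩ Gord @ 3, out of reach: no `p = 3` big-image tower). THIS FILE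
supplies the class wrappers for those cells over ONE series-agnostic step:

* §0 `padicVal_sha_add_le_and_iff_of_iota_eq_C_mul` (per datum): ANY `g ∈ char_Λ X` with `ι g = C(u·c)·S`,
  `(c·S)(0) ≠ 0`, `v_p((c·S)(0)) + 2t = ord_p s + ord_p ∏c` ⟹ Delbourgo's `ℓ ∣ p²` has
  `ord_p #Ш[p^∞] + ord_p ℓ ≤ ord_p s`, `=` ⟺ `char_Λ X = (g)`; and `ord_p s ≤ ord_p #Ш[p^∞]` ⟹
  `char = (g)`, `ℓ = 1`, `ord_p #Ш[p^∞] = ord_p s`;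
* §1 **`ClassX4M.bsdp_and_charIdeal_eq_span_kato_of_shaAn_le_card_rankZero`** (X4(M) ∩ surj, every odd `p`,
  (B)-datum binder): `ord_p #Ш_an ≤ ord_p #Ш[p^∞]` ⟹ `BSD(E,p)` ∧ per twist datum / cyclotomic datum the
  Kato element generates and `ℓ = 1`; §2 **`ClassX3M.…`**, §3 **`ClassX3Gord.…_wuthrich_…`** (`E[p]`
  reducible, every odd `p`).

Since `BSD(E,p)` itself is such a lower bound, on all these rows `BSD(E,p)` ⟹ MC(pair) integrally ∧
`ℓ = 1`. Nothing booked; labels UNCHANGED.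

References: Kato 2004 Thm. 17.4 (3) [Kato2004Asterisque]; Wuthrich 2014 Thm. 16, Lemma 20 [Wuthrich2014];
Delbourgo 2002 Thm. (A), (B) p. 40, p. 39 [Delbourgo2002]; Greenberg–Vatsal 2000 p. 4 [GreenbergVatsal2000];
Miller 2011 Def. 1.1 [Miller2011LMS]; gen 32 parts 4, 5, 6. -/

set_option autoImplicit false

noncomputable section

open scoped Classical MatrixGroups ModularForm NumberField

open CongruenceSubgroup IsDedekindDomain WeierstrassCurve NumberField
  Literature.NumberTheory.EllipticCurves
  Literature.NumberTheory.EllipticCurves.ModularForms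
  Literature.NumberTheory.EllipticCurves.Rank1Residual
  Literature.NumberTheory.EllipticCurves.Rank1Residual.Typed
  Literature.NumberTheory.EllipticCurves.Delbourgo2002
  Literature.NumberTheory.GaloisRepresentations
  Summit.BirchSwinnertonDyer.Rank1Residual.AdditivePotMult
  Summit.BirchSwinnertonDyer.Rank1Residual.X1.MuLambda
  Summit.BirchSwinnertonDyer.Rank1Residual.X1.RankOneParitySqueeze
  Summit.BirchSwinnertonDyer.Rank1Residual.X11a.LambdaNorm

namespace Summit.BirchSwinnertonDyer.Rank1Residual.Additive

/-! ### §0 Per datum, series-agnostic: the upper half with `ℓ`, its equality case, and the lower bound -/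

namespace TameBranchAnalyticSha

variable {W : WeierstrassCurve ℚ} [W.IsElliptic] {p : ℕ} [hp : Fact p.Prime]

/-- **Per datum, series-agnostic (rank 0).** `rank_ℤ E(ℚ) = 0`, a (B)-datum, a cyclotomic dual datum with
`X` torsion, ANY `g ∈ char_Λ X` with `ι g = C(u·c)·S` (`u ∈ ℤ_p^×`), `(c·S)(0) ≠ 0` and the dictionary
`v_p((c·S)(0)) + 2·ord_p #tors = ord_p s + ord_p ∏c`. Then Delbourgo's `ℓ ∣ p²` (`= 1` off the anomalous
rows) has **`ord_p #Ш[p^∞] + ord_p ℓ ≤ ord_p s`, EQUALITY ⟺ `char_Λ X = (g)`**, and a LOWER bound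
**`ord_p s ≤ ord_p #Ш[p^∞]` ⟹ `char_Λ X = (g)`, `ℓ = 1`, `ord_p #Ш[p^∞] = ord_p s`** (part 6 §1).
[cite: Delbourgo2002, Theorem (B) (p. 40)] [cite: GreenbergVatsal2000, p. 4 (after Thm. (1.2))] -/
theorem padicVal_sha_add_le_and_iff_of_iota_eq_C_mul
    (hr0 : W.mordellWeilRank = 0) {Dh : PAdicHeightData W p} (hBcl : LeadingTermClauses W p Dh)
    {κ : ZpExtension ℚ p} {γ : Field.absoluteGaloisGroup ℚ}
    (hκ : κ.IsCyclotomic) (hγ : κ.IsTopGenerator γ) (hγ' : IsCyclotomicVariable p γ)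
    (D : W.SelmerDualData κ γ) [Module.Finite (IwasawaAlgebra p) D.X] (hX : D.IsTorsion)
    {g : IwasawaAlgebra p} (hg : g ∈ D.charIdeal) {u : ℤ_[p]ˣ} {c : ℚ_[p]} {S : PowerSeries ℚ_[p]}
    (hι : iwasawaToPowerSeries p g = PowerSeries.C (((u : ℤ_[p]) : ℚ_[p]) * c) * S)
    (hS0 : PowerSeries.constantCoeff (PowerSeries.C c * S) ≠ 0) {s : ℚ}
    (hdict : (PowerSeries.constantCoeff (PowerSeries.C c * S)).valuation + 2 * padicValNat p W.torsionOrder =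
      padicValRat p s + padicValNat p W.tamagawaProduct) :
    Finite (AddCommGroup.primaryComponent W.sha p) ∧
      ∃ ℓ : ℕ, ℓ ∣ p ^ 2 ∧ (ReductionNonAnomalous W p → ℓ = 1) ∧
        (padicValNat p (Nat.card (AddCommGroup.primaryComponent W.sha p)) : ℤ) + padicValNat p ℓ ≤
          padicValRat p s ∧
        (D.charIdeal = Ideal.span {g} ↔
          (padicValNat p (Nat.card (AddCommGroup.primaryComponent W.sha p)) : ℤ) + padicValNat p ℓ =
            padicValRat p s) ∧
        (padicValRat p s ≤ padicValNat p (Nat.card (AddCommGroup.primaryComponent W.sha p)) →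
          D.charIdeal = Ideal.span {g} ∧ ℓ = 1 ∧
            (padicValNat p (Nat.card (AddCommGroup.primaryComponent W.sha p)) : ℤ) = padicValRat p s) := by
  have hX0eq : PowerSeries.constantCoeff (PowerSeries.C (((u : ℤ_[p]) : ℚ_[p]) * c) * S) =
      ((u : ℤ_[p]) : ℚ_[p]) * PowerSeries.constantCoeff (PowerSeries.C c * S) := by
    simp only [map_mul, PowerSeries.constantCoeff_C]; ring
  have hX0 : PowerSeries.constantCoeff (PowerSeries.C (((u : ℤ_[p]) : ℚ_[p]) * c) * S) ≠ 0 := by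
    rw [hX0eq]; exact mul_ne_zero (coe_units_ne_zero p u) hS0
  have hvX : (PowerSeries.constantCoeff (PowerSeries.C (((u : ℤ_[p]) : ℚ_[p]) * c) * S)).valuation +
      2 * padicValNat p W.torsionOrder = padicValRat p s + padicValNat p W.tamagawaProduct := by
    rw [hX0eq, Padic.valuation_mul (coe_units_ne_zero p u) hS0, valuation_coe_units_eq_zero, zero_add, hdict]
  haveI : (Literature.NumberTheory.EllipticCurves.Module.charIdeal (IwasawaAlgebra p) D.X).IsPrincipal :=
    charIdeal_isPrincipal_holds p D.X
  obtain ⟨fE, hchar⟩ := Submodule.IsPrincipal.principal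
    (Literature.NumberTheory.EllipticCurves.Module.charIdeal (IwasawaAlgebra p) D.X)
  obtain ⟨hfin, ℓ, hℓp, hℓ1, hle, hiff⟩ := charIdeal_eq_span_iff_valuation_eq_rankZero_of_iota_eq hr0 hBcl
    hκ hγ hγ' D hX hchar hg hι hX0
  have hle' : (padicValNat p (Nat.card (AddCommGroup.primaryComponent W.sha p)) : ℤ) + padicValNat p ℓ ≤
      padicValRat p s := by linarith
  have hiff' : D.charIdeal = Ideal.span {g} ↔
      (padicValNat p (Nat.card (AddCommGroup.primaryComponent W.sha p)) : ℤ) + padicValNat p ℓ =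
        padicValRat p s := by
    rw [hiff]; constructor <;> intro e <;> linarith
  refine ⟨hfin, ℓ, hℓp, hℓ1, hle', hiff', fun hlow ↦ ?_⟩
  have h0 : (0 : ℤ) ≤ padicValNat p ℓ := by exact_mod_cast Nat.zero_le _
  have hℓ0 : padicValNat p ℓ = 0 := by
    have : (padicValNat p ℓ : ℤ) ≤ 0 := by linarith
    omega
  have hcardeq : (padicValNat p (Nat.card (AddCommGroup.primaryComponent W.sha p)) : ℤ) = padicValRat p s := by
    have h := hle'; rw [hℓ0, Nat.cast_zero, add_zero] at h; exact le_antisymm h hlow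
  refine ⟨hiff'.mpr (by rw [hℓ0, Nat.cast_zero, add_zero]; exact hcardeq),
    TameBranchFullSqueeze.eq_one_of_dvd_prime_sq_of_padicValNat_eq_zero hℓp hℓ0, hcardeq⟩

end TameBranchAnalyticSha

section Twins

open TameBranchMuPart TameBranchAnalyticSha

variable {W : WeierstrassCurve ℚ} [W.IsElliptic] [W.IsGloballyMinimal] {p : ℕ} [hp : Fact p.Prime]

/-! ### §1 X4(M) ∩ {`ρ̄` onto}, EVERY odd `p` -/

/-- **X4(M): A LOWER BOUND ON `#Ш(E)[p^∞]` (in particular `BSD(E,p)`) ⟹ `BSD(E,p)` + THE MAIN CONJECTURE AT THE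
PAIR + `ℓ = 1`.** X4(M) ∩ {`ρ̄_{E,p}` onto}, EVERY odd `p`, `ord_{s=1} L(E,s) = 0`, a (B)-datum `Dh`
(`mainTheorem_potMult`), `#Ш_an(E) = s ∈ ℚ` with **`ord_p s ≤ ord_p #Ш(E/ℚ)[p^∞]`**. Then `BSDp W p`, and for
every multiplicative twist model `V` (`C • V^{(p*)} = W`), newform `f` of `V`, period ratio `ϖ` and every
cyclotomic dual datum: the Kato element `g` (`ι g = u·ϖ·L^±_p(f, a_p(V))`) GENERATES `char_Λ X(E/ℚ_∞)`,
Delbourgo's `ℓ = 1`, `ord_p #Ш[p^∞] = ord_p s`. [cite: Kato2004Asterisque, Thm. 17.4 (3) (p. 273)]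
[cite: Wuthrich2014, Lemma 20] [cite: Delbourgo2002, Theorem (A), (B) (p. 40), p. 39]
[cite: Miller2011LMS, Def. 1.1 (arXiv:1010.2431 p. 3)] -/
theorem ClassX4M.bsdp_and_charIdeal_eq_span_kato_of_shaAn_le_card_rankZero
    (hK : Wuthrich2014.kato_halfEigenCharIdeal_dvd_cyclotomicPrime_of_surjective)
    (hGZK : rank_eq_analyticRank_of_analyticRank_le_one) (hmod : hasEntireLFunction_rat)
    (hX : ClassX4M W p) (hsurj : Surj W p) (hr : W.analyticRank = 0)
    {Dh : PAdicHeightData W p} (hBcl : LeadingTermClauses W p Dh)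
    {s : ℚ} (hs : shaAn W = (s : ℂ))
    (hlow : padicValRat p s ≤ padicValNat p (Nat.card (AddCommGroup.primaryComponent W.sha p)))
    (V : WeierstrassCurve ℚ) [V.IsElliptic] [V.IsGloballyMinimal] (C : VariableChange ℚ)
    (hC : C • V.quadraticTwist ((-1 : ℚ) ^ (p / 2) * p) = W) (hV : Mult V p)
    {N : ℕ} [NeZero N] {f : CuspForm (Gamma0 N) 2} (hf : IsNewformOf V f)
    (ϖ : ℚ) (hϖ : if Even (p / 2) then (ϖ : ℝ) * V.realPeriodRat = plusPeriod f
      else (ϖ : ℝ) * V.imaginaryPeriodRat = minusPeriod f)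
    {κ : ZpExtension ℚ p} {γ : Field.absoluteGaloisGroup ℚ}
    (hκ : κ.IsCyclotomic) (hγ : κ.IsTopGenerator γ) (hγ' : IsCyclotomicVariable p γ)
    (D : W.SelmerDualData κ γ) :
    BSDp W p ∧ ∃ (g : IwasawaAlgebra p) (u : ℤ_[p]ˣ) (ℓ : ℕ), D.charIdeal = Ideal.span {g} ∧
      iwasawaToPowerSeries p g = PowerSeries.C (((u : ℤ_[p]) : ℚ_[p]) * (ϖ : ℚ_[p])) *
        (if Even (p / 2) then padicLFunctionPlusBranchMult f ((V.LFunction p : ℤ) : ℚ_[p]) (p / 2)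
          else padicLFunctionMinusBranchMult f ((V.LFunction p : ℤ) : ℚ_[p]) (p / 2)) ∧
      ℓ ∣ p ^ 2 ∧ ℓ = 1 ∧
      (padicValNat p (Nat.card (AddCommGroup.primaryComponent W.sha p)) : ℤ) = padicValRat p s := by
  have hp2 : p ≠ 2 := hX.p_ne_two
  have hadd : Addv W p := hX.1.2.1
  obtain ⟨hmw, -⟩ := hGZK W (by rw [hr]; norm_num)
  have hr0 : W.mordellWeilRank = 0 := by rw [hmw, hr]
  have hL : W.entireLFunction 1 ≠ 0 := (W.analyticRank_eq_zero_iff_holds (hmod W)).mp hr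
  have hsurjV : ∀ n : ℕ, V.HasSurjectiveModNGaloisRep (p ^ n : ℕ) :=
    (ClassX4M.potMult W p hX).towerSurj_twist_of_surj hp2 hsurj V C hC
  haveI : Module.Finite (IwasawaAlgebra p) D.X :=
    SelmerDualData.module_finite_of_isCyclotomic (W := W) (κ := κ) hκ D hγ
  obtain ⟨hap, -, -⟩ := cuspCoeff_eq_and_ne_zero_and_dvd_of_mult p hf hV
  obtain ⟨h0, hdict⟩ := valuation_constantCoeff_branchMult_add_eq_padicValRat_shaAn_add hmod hGZK hp2 hadd
    hL V C hC hV hf hap ϖ hϖ hs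
  have hbrick : D.IsTorsion ∧ ∃ g ∈ D.charIdeal, ∃ u : ℤ_[p]ˣ,
      iwasawaToPowerSeries p g = PowerSeries.C (((u : ℤ_[p]) : ℚ_[p]) * (ϖ : ℚ_[p])) *
        (if Even (p / 2) then padicLFunctionPlusBranchMult f ((V.LFunction p : ℤ) : ℚ_[p]) (p / 2)
          else padicLFunctionMinusBranchMult f ((V.LFunction p : ℤ) : ℚ_[p]) (p / 2)) := by
    by_cases hsp : V.HasSplitMultiplicativeReductionAtPrime p
    · have hap1 : V.LFunction p = 1 := by
        have e : ((V.LFunction p : ℤ) : ℂ) = ((1 : ℤ) : ℂ) := by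
          rw [← hap, (hf.cuspCoeff_eq_one_and_sq_of_split hsp).1, Int.cast_one]
        exact_mod_cast e
      rw [hap1]
      simpa only [Int.cast_one] using isTorsion_and_exists_iota_eq_of_katoHalf hK hp2 V C hC hsurjV hκ
        hγ hγ' hf D _ (Or.inr (Or.inl ⟨hsp, rfl⟩)) ϖ hϖ
    · have hap1 : V.LFunction p = -1 := by
        have e : ((V.LFunction p : ℤ) : ℂ) = ((-1 : ℤ) : ℂ) := by
          rw [← hap, (hf.cuspCoeff_eq_neg_one_and_dvd_of_nonsplit hV hsp).1, Int.cast_neg, Int.cast_one]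
        exact_mod_cast e
      rw [hap1]
      simpa only [Int.cast_neg, Int.cast_one] using isTorsion_and_exists_iota_eq_of_katoHalf hK hp2 V C
        hC hsurjV hκ hγ hγ' hf D _ (Or.inr (Or.inr ⟨hV, hsp, rfl⟩)) ϖ hϖ
  obtain ⟨hXt, g, hg, u, hι⟩ := hbrick
  obtain ⟨hfin, ℓ, hℓp, -, -, -, hlow'⟩ := padicVal_sha_add_le_and_iff_of_iota_eq_C_mul hr0 hBcl hκ hγ hγ' D
    hXt hg hι h0 hdict
  obtain ⟨hspan, hℓ1, hcard⟩ := hlow' hlow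
  exact ⟨⟨hmw, hfin, s, hs, hcard.symm⟩, g, u, ℓ, hspan, hι, hℓp, hℓ1, hcard⟩

/-! ### §2 X3♯(M) (`E[p]` reducible), EVERY odd `p` -/

/-- **X3♯(M): a lower bound on `#Ш(E)[p^∞]` (in particular `BSD(E,p)`) ⟹ `BSD(E,p)` + the Wuthrich element
generates + `ℓ = 1`.** X3♯(M), `p` odd, `ord_{s=1} L(E,s) = 0`, a (B)-datum (`mainTheorem_potMult`),
`#Ш_an(E) = s` with `ord_p s ≤ ord_p #Ш[p^∞]`; conclusion as in §1 for Wuthrich's element.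
[cite: Wuthrich2014, Thm. 16 (p. 397)] [cite: Delbourgo2002, Theorem (A), (B) (p. 40), p. 39]
[cite: Miller2011LMS, Def. 1.1 (arXiv:1010.2431 p. 3)] -/
theorem ClassX3M.bsdp_and_charIdeal_eq_span_wuthrich_of_shaAn_le_card_rankZero
    (hWu : Wuthrich2014.thm16_halfEigenCharIdeal_dvd_cyclotomicPrime)
    (hGZK : rank_eq_analyticRank_of_analyticRank_le_one) (hmod : hasEntireLFunction_rat)
    (hX : ClassX3M W p) (hr : W.analyticRank = 0)
    {Dh : PAdicHeightData W p} (hBcl : LeadingTermClauses W p Dh)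
    {s : ℚ} (hs : shaAn W = (s : ℂ))
    (hlow : padicValRat p s ≤ padicValNat p (Nat.card (AddCommGroup.primaryComponent W.sha p)))
    (V : WeierstrassCurve ℚ) [V.IsElliptic] [V.IsGloballyMinimal] (C : VariableChange ℚ)
    (hC : C • V.quadraticTwist ((-1 : ℚ) ^ (p / 2) * p) = W) (hV : Mult V p)
    {N : ℕ} [NeZero N] {f : CuspForm (Gamma0 N) 2} (hf : IsNewformOf V f)
    (ϖ : ℚ) (hϖ : if Even (p / 2) then (ϖ : ℝ) * V.realPeriodRat = plusPeriod f
      else (ϖ : ℝ) * V.imaginaryPeriodRat = minusPeriod f)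
    {κ : ZpExtension ℚ p} {γ : Field.absoluteGaloisGroup ℚ}
    (hκ : κ.IsCyclotomic) (hγ : κ.IsTopGenerator γ) (hγ' : IsCyclotomicVariable p γ)
    (D : W.SelmerDualData κ γ) :
    BSDp W p ∧ ∃ (g : IwasawaAlgebra p) (u : ℤ_[p]ˣ) (ℓ : ℕ), D.charIdeal = Ideal.span {g} ∧
      iwasawaToPowerSeries p g = PowerSeries.C (((u : ℤ_[p]) : ℚ_[p]) * (ϖ : ℚ_[p])) *
        (if Even (p / 2) then padicLFunctionPlusBranchMult f ((V.LFunction p : ℤ) : ℚ_[p]) (p / 2)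
          else padicLFunctionMinusBranchMult f ((V.LFunction p : ℤ) : ℚ_[p]) (p / 2)) ∧
      ℓ ∣ p ^ 2 ∧ ℓ = 1 ∧
      (padicValNat p (Nat.card (AddCommGroup.primaryComponent W.sha p)) : ℤ) = padicValRat p s := by
  have hp2 : p ≠ 2 := hX.p_ne_two
  have hadd : Addv W p := hX.classX3.2
  obtain ⟨hmw, -⟩ := hGZK W (by rw [hr]; norm_num)
  have hr0 : W.mordellWeilRank = 0 := by rw [hmw, hr]
  have hL : W.entireLFunction 1 ≠ 0 := (W.analyticRank_eq_zero_iff_holds (hmod W)).mp hr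
  have hirrV : ¬ V.HasIrreducibleModPGaloisRep p := fun hVirr ↦
    hX.classX3.1 ((irr_iff_of_model_twist (W := V) (p := p) (pStar_ne_zero p) ⟨C, hC⟩).mpr hVirr)
  haveI : Module.Finite (IwasawaAlgebra p) D.X :=
    SelmerDualData.module_finite_of_isCyclotomic (W := W) (κ := κ) hκ D hγ
  obtain ⟨hap, -, -⟩ := cuspCoeff_eq_and_ne_zero_and_dvd_of_mult p hf hV
  obtain ⟨h0, hdict⟩ := valuation_constantCoeff_branchMult_add_eq_padicValRat_shaAn_add hmod hGZK hp2 hadd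
    hL V C hC hV hf hap ϖ hϖ hs
  have hbrick : D.IsTorsion ∧ ∃ g ∈ D.charIdeal, ∃ u : ℤ_[p]ˣ,
      iwasawaToPowerSeries p g = PowerSeries.C (((u : ℤ_[p]) : ℚ_[p]) * (ϖ : ℚ_[p])) *
        (if Even (p / 2) then padicLFunctionPlusBranchMult f ((V.LFunction p : ℤ) : ℚ_[p]) (p / 2)
          else padicLFunctionMinusBranchMult f ((V.LFunction p : ℤ) : ℚ_[p]) (p / 2)) := by
    by_cases hsp : V.HasSplitMultiplicativeReductionAtPrime p
    · have hap1 : V.LFunction p = 1 := by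
        have e : ((V.LFunction p : ℤ) : ℂ) = ((1 : ℤ) : ℂ) := by
          rw [← hap, (hf.cuspCoeff_eq_one_and_sq_of_split hsp).1, Int.cast_one]
        exact_mod_cast e
      rw [hap1]
      simpa only [Int.cast_one] using isTorsion_and_exists_iota_eq_of_wuthrichHalf hWu hp2 V C hC hirrV hκ
        hγ hγ' hf D _ (Or.inr (Or.inl ⟨hsp, rfl⟩)) ϖ hϖ
    · have hap1 : V.LFunction p = -1 := by
        have e : ((V.LFunction p : ℤ) : ℂ) = ((-1 : ℤ) : ℂ) := by
          rw [← hap, (hf.cuspCoeff_eq_neg_one_and_dvd_of_nonsplit hV hsp).1, Int.cast_neg, Int.cast_one]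
        exact_mod_cast e
      rw [hap1]
      simpa only [Int.cast_neg, Int.cast_one] using isTorsion_and_exists_iota_eq_of_wuthrichHalf hWu hp2 V
        C hC hirrV hκ hγ hγ' hf D _ (Or.inr (Or.inr ⟨hV, hsp, rfl⟩)) ϖ hϖ
  obtain ⟨hXt, g, hg, u, hι⟩ := hbrick
  obtain ⟨hfin, ℓ, hℓp, -, -, -, hlow'⟩ := padicVal_sha_add_le_and_iff_of_iota_eq_C_mul hr0 hBcl hκ hγ hγ' D
    hXt hg hι h0 hdict
  obtain ⟨hspan, hℓ1, hcard⟩ := hlow' hlow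
  exact ⟨⟨hmw, hfin, s, hs, hcard.symm⟩, g, u, ℓ, hspan, hι, hℓp, hℓ1, hcard⟩

/-! ### §3 X3♯(G-ord, `e = 2`) ∩ `I₀*` (`E[p]` reducible), EVERY odd `p` -/

/-- **X3♯(G-ord): a lower bound on `#Ш(E)[p^∞]` (in particular `BSD(E,p)`) ⟹ `BSD(E,p)` + the Wuthrich
element generates + `ℓ = 1`.** X3♯(G-ord) ∩ `I₀*`, `p` odd, `e = 2`, `ord_{s=1} L(E,s) = 0`, a (B)-datum
(A175 / `mainTheorem_three`), `#Ш_an(E) = s` with `ord_p s ≤ ord_p #Ш[p^∞]`; good-ordinary twist data.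
[cite: Wuthrich2014, Thm. 16 (p. 397)] [cite: Delbourgo2002, Theorem (A), (B) (p. 40)]
[cite: MazurTateTeitelbaum1986Invent, §I.8 (8.6), §I.13–I.14] [cite: Miller2011LMS, Def. 1.1 (arXiv:1010.2431 p. 3)] -/
theorem ClassX3Gord.bsdp_and_charIdeal_eq_span_wuthrich_of_shaAn_le_card_rankZero
    (hWu : Wuthrich2014.thm16_halfEigenCharIdeal_dvd_cyclotomicPrime)
    (hGZK : rank_eq_analyticRank_of_analyticRank_le_one) (hmod : hasEntireLFunction_rat)
    (hX : ClassX3Gord W p) (hp2 : p ≠ 2) (hr : W.analyticRank = 0)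
    {Dh : PAdicHeightData W p} (hBcl : LeadingTermClauses W p Dh)
    {s : ℚ} (hs : shaAn W = (s : ℂ))
    (hlow : padicValRat p s ≤ padicValNat p (Nat.card (AddCommGroup.primaryComponent W.sha p)))
    (V : WeierstrassCurve ℚ) [V.IsElliptic] [V.IsGloballyMinimal] (C : VariableChange ℚ)
    (hC : C • V.quadraticTwist ((-1 : ℚ) ^ (p / 2) * p) = W) (hV : GoodOrd V p)
    {N : ℕ} [NeZero N] {f : CuspForm (Gamma0 N) 2} (hf : IsNewformOf V f)
    (ϖ : ℚ) (hϖ : if Even (p / 2) then (ϖ : ℝ) * V.realPeriodRat = plusPeriod f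
      else (ϖ : ℝ) * V.imaginaryPeriodRat = minusPeriod f)
    {κ : ZpExtension ℚ p} {γ : Field.absoluteGaloisGroup ℚ}
    (hκ : κ.IsCyclotomic) (hγ : κ.IsTopGenerator γ) (hγ' : IsCyclotomicVariable p γ)
    (D : W.SelmerDualData κ γ) :
    BSDp W p ∧ ∃ (g : IwasawaAlgebra p) (u : ℤ_[p]ˣ) (ℓ : ℕ), D.charIdeal = Ideal.span {g} ∧
      iwasawaToPowerSeries p g = PowerSeries.C (((u : ℤ_[p]) : ℚ_[p]) * (ϖ : ℚ_[p])) *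
        (if Even (p / 2) then padicLFunctionBranch f ((unitRoot V p : ℤ_[p]) : ℚ_[p]) (p / 2)
          else padicLFunctionMinusBranch f ((unitRoot V p : ℤ_[p]) : ℚ_[p]) (p / 2)) ∧
      ℓ ∣ p ^ 2 ∧ ℓ = 1 ∧
      (padicValNat p (Nat.card (AddCommGroup.primaryComponent W.sha p)) : ℤ) = padicValRat p s := by
  have hadd : Addv W p := hX.addv
  obtain ⟨hmw, -⟩ := hGZK W (by rw [hr]; norm_num)
  have hr0 : W.mordellWeilRank = 0 := by rw [hmw, hr]
  have hL : W.entireLFunction 1 ≠ 0 := (W.analyticRank_eq_zero_iff_holds (hmod W)).mp hr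
  have hΩ : (W.realPeriodRat : ℂ) ≠ 0 := by exact_mod_cast W.realPeriodRat_pos_holds.ne'
  have hj := padicValRat_j_nonneg_of_typeGOrd W p hX.typeGOrd
  have hord : IsOrdinaryAt V p :=
    isOrdinaryAt_of_goodOrd_or_mult_of_model_twist W V (pStar_ne_zero p) ⟨C, hC⟩ hj (Or.inl hV)
  haveI : Module.Finite (IwasawaAlgebra p) D.X :=
    SelmerDualData.module_finite_of_isCyclotomic (W := W) (κ := κ) hκ D hγ
  obtain ⟨hXt, g, hg, u, hι⟩ := isTorsion_and_exists_iota_eq_branch_of_wuthrichComponent W p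
    (Wuthrich2014.charIdeal_dvd_padicLFunctionBranch_component_of_half hWu) hj hp2 V
    ⟨C, hC⟩ (Or.inl hV) hX.classX3.1 hκ hγ hγ' hf D ϖ hϖ
  obtain ⟨q, u', hu'0, -, hLq, hA⟩ :=
    exists_rat_and_unit_constantCoeff_branch_eq hmod hp2 hadd V C hC hord hf ϖ hϖ
  have hq0 : q ≠ 0 := by
    intro h0'; apply hL
    have e : W.entireLFunction 1 = (q : ℂ) * (W.realPeriodRat : ℂ) := by rw [← hLq, div_mul_cancel₀ _ hΩ]
    rw [e, h0', Rat.cast_zero, zero_mul]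
  have hS0 : PowerSeries.constantCoeff (PowerSeries.C (ϖ : ℚ_[p]) *
      (if Even (p / 2) then padicLFunctionBranch f ((unitRoot V p : ℤ_[p]) : ℚ_[p]) (p / 2)
        else padicLFunctionMinusBranch f ((unitRoot V p : ℤ_[p]) : ℚ_[p]) (p / 2))) ≠ 0 := by
    rw [hA]; exact mul_ne_zero hu'0 (by exact_mod_cast hq0)
  have hdict := valuation_constantCoeff_branch_add_eq_padicValRat_shaAn_add hmod hGZK hp2 hadd hL V C hC
    hord hf ϖ hϖ hs
  obtain ⟨hfin, ℓ, hℓp, -, -, -, hlow'⟩ := padicVal_sha_add_le_and_iff_of_iota_eq_C_mul hr0 hBcl hκ hγ hγ' D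
    hXt hg hι hS0 hdict
  obtain ⟨hspan, hℓ1, hcard⟩ := hlow' hlow
  exact ⟨⟨hmw, hfin, s, hs, hcard.symm⟩, g, u, ℓ, hspan, hι, hℓp, hℓ1, hcard⟩

end Twins

end Summit.BirchSwinnertonDyer.Rank1Residual.Additive

end
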